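import Literature.AnabelianGeometry.EtaleTheta.FrobenioidThetaDivisors
import HarnessLib

/-!
# [EtTh] §5, Prop. 5.3: the F1 datum «the image of the birational function monoid in `Φ(A_⊚)^gp`» READ IN PRINT'S TERMS
# (DEFS lane, class (b): two definitions, statement-only; the transport theorems are the proof-only companion
# `FrobenioidThetaDivisorPrincipalTransport.lean`)

S. Mochizuki, *The étale theta function and its Frobenioid-theoretic manifestations*, Publ. RIMS **45** (2009)
[MochizukiEtTh2009]: §4 p. 312 (PDF p. 86) «pre-steps of `C` map to isomorphisms in `C^birat` [cf. [FrdI], Proposition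
4.4, (iv)] … any base-equivalent pair of pre-steps `s′, s″ : A → B` … determines … an element "`s′·(s″)⁻¹`" `∈ O^×(A^birat)`»;
Prop. 5.3 proof p. 326 (PDF p. 100) (linear equivalence of divisors on the special fibre through «the image of the
birational function monoid»); S. Mochizuki, *The geometry of Frobenioids I*, Kyushu J. Math. **62** (2008) [MochizukiFrdI2008]:
Prop. 4.4 p. 82–84 (`O^×(A^birat)` and its divisor map to `Φ(A)^gp`).
[cite: MochizukiEtTh2009, §4 p.312 (PDF p.86)] [cite: MochizukiEtTh2009, Prop 5.3 proof p.326 (PDF p.100)]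
[cite: MochizukiFrdI2008, Prop. 4.4 p.83]

Cell abc-iut, layer L2 ([EtTh] §5), seat abc-iut-L6-d1 (gen 5), row «F1-BIRAT» (abc-iut-L2-lead R453 GO 2026-08-26T14:33Z),
successor of this lineage's perfect-`Φ` support vocabulary `DivisorSupportDataQ` (p441752) and its capstone
`DivisorSupportDataQ.geometryOfDivisorsPreserved_of_principalQ` (p447501), whose field F1 `principal : Subgroup Φ(A_⊚)^gp`
is free DATA and whose hypotheses F1-Ψ (`hP`) and F1-Aut (`hAP`) are BINDERS.  This file gives F1 its printed MEANING over
ANY operations `S : PreFrobenioidData C D` ([FrdI] Def. 1.1 (iv)) and `A ∈ Ob(C)`: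
* `principalGenerators S A` — the divisors `Div(s′) − Div(s″) ∈ Φ(A)^gp` (multiplicatively `of (Div s′) / of (Div s″)`) of
  the base-equivalent pairs of pre-steps `s′, s″ : A → B` — the divisors of zeroes and poles of the rational functions
  "`s′·(s″)⁻¹ ∈ O^×(A^birat)`" of [EtTh] §4 p. 312;
* `principalDivisors S A` — the subgroup of `Φ(A)^gp` they generate: print's «image of the birational function monoid» at
  `A` (Prop. 5.3 proof p. 326), in the `PreFrobenioidData` presentation that the §5 data `ThetaFrobenioid.pre` use.
RELATION (no bridge claimed): abc-iut-L1's `PreFrobenioid.BiratUnits.divHomRange` ([FrdI] Prop. 4.4 (iii), pairs of co-angular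
pre-steps INTO `A`, `C ⥤ F_Φ` presentation) is the same printed object.  With `principal := principalDivisors 𝔉.pre A_⊚` the
companion proves F1-Aut outright and F1-Ψ modulo [FrdI] Thm. 4.9 / 3.4 (ii)(v).
HONEST FRAMING: two definitions about OUR typed operations; nothing here asserts a result of [EtTh] for an actual curve;
typed ≠ proved; no side is taken on [IUTchIII] Cor. 3.12.
-/

namespace Literature.AnabelianGeometry.EtaleTheta

open CategoryTheory
open Literature.AlgebraicGeometry.Frobenioids

universe w v v' u u'

namespace FrobenioidThetaDivisors

variable {C : Type u} [Category.{v} C] {D : Type u'} [Category.{v'} D]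

section PreData

variable (S : PreFrobenioidData.{w} C D)

/-- **The divisors of the rational functions `s′·(s″)⁻¹`** ([EtTh] §4 p. 312 (PDF p. 86)): for base-equivalent pairs
of pre-steps `s′, s″ : A → B` of `C`, the elements `Div(s′) − Div(s″)` of `Φ(A)^gp` (multiplicatively
`of (Div s′) / of (Div s″)`; [FrdI] Prop. 4.4 (i): the divisor of a morphism of `C^birat`).
[cite: MochizukiEtTh2009, §4 p.312 (PDF p.86)] [cite: MochizukiFrdI2008, Prop. 4.4 p.83] -/
def principalGenerators (A : C) : Set (Algebra.GrothendieckGroup (S.Mon (S.base.obj A))) :=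
  {x | ∃ (B : C) (s s' : A ⟶ B), S.IsPreStep s ∧ S.IsPreStep s' ∧ S.BaseEquivalent s s' ∧
    x = Algebra.GrothendieckGroup.of (S.div s) / Algebra.GrothendieckGroup.of (S.div s')}

/-- **«The image of the birational function monoid» of `C` in `Φ(A)^gp`** (Prop. 5.3 proof p. 326 (PDF p. 100); the F1
datum of the support vocabularies `DivisorSupportData'` / `DivisorSupportDataQ`): the subgroup of `Φ(A)^gp` generated by
the divisors of the rational functions `s′·(s″)⁻¹ ∈ O^×(A^birat)` of the base-equivalent pairs of pre-steps out of `A`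
([EtTh] §4 p. 312; [FrdI] Prop. 4.4).  [cite: MochizukiEtTh2009, Prop 5.3 proof p.326 (PDF p.100)] [cite: MochizukiFrdI2008, Prop. 4.4 p.83] -/
def principalDivisors (A : C) : Subgroup (Algebra.GrothendieckGroup (S.Mon (S.base.obj A))) :=
  Subgroup.closure (principalGenerators S A)

variable {S}

/-- Membership in the generating set, unfolded. [cite: MochizukiEtTh2009, §4 p.312 (PDF p.86)] -/
theorem mem_principalGenerators_iff {A : C} (x : Algebra.GrothendieckGroup (S.Mon (S.base.obj A))) :
    x ∈ principalGenerators S A ↔ ∃ (B : C) (s s' : A ⟶ B), S.IsPreStep s ∧ S.IsPreStep s' ∧ S.BaseEquivalent s s' ∧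
      x = Algebra.GrothendieckGroup.of (S.div s) / Algebra.GrothendieckGroup.of (S.div s') :=
  Iff.rfl

end PreData

end FrobenioidThetaDivisors

end Literature.AnabelianGeometry.EtaleTheta
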